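import Summits.Parity.GeneralizedHardyLittlewood.Theses.LeeYangFibres
import Summits.Parity.GeneralizedHardyLittlewood.Theorems.LeeYangFibresCellParityLawDefs
import Summits.Parity.GeneralizedHardyLittlewood.Theorems.LeeYangFibresCellParityLawKernelDefs
import Summits.Parity.GeneralizedHardyLittlewood.Theorems.LeeYangFibresAbsoluteUpgradeDipDefs
import Summits.Parity.GeneralizedHardyLittlewood.Theorems.LeeYangFibresAbsoluteUpgradeQuantClipNumerics
import HarnessLib

/-!
# Route `LeeYangFibres`, crux `CellParityLawSaving` (stmt-Parity-18104): vocabulary of the line `superpoly-band-same-atom`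

Route-posited STATEMENTS (D-0016 `<Route><Crux>Defs` file) shared by the registered stubs of the skeleton
`Cruxes/CellParityLawSaving/Lines/SketchIdeator3.lean` (line lead `prover-line-stmt-Parity-18104-0`, opening lead,
2026-08-17) and by the files that prove and compose them. NOTHING IS ASSERTED: every `def … : Prop` below is a
*statement* — the type of a registered stub or of a hypothesis of one — consumed only as such. The three theorems of
this file (`composeSav`, `cellParityLawSaving_of_lawSavAt`, `sectionLevelAt_of_along`) are pure logic / bookkeeping
and fully proved. No object is posited: the cells `cell`, model densities `modelDensity`, Walsh factor `walsh`,
section data `sectionMass` / `sectionDensity` are the sister crux's (`LeeYangFibresCellParityLawDefs`, VERBATIM the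
inlined objects of the route decls), the schedule `slowDegree N = max 4 ⌊√(log log N)/2⌋₊` is the dip line's
(`LeeYangFibresAbsoluteUpgradeDipDefs`), the one-sequence kernel vocabulary (`SieveSequence`, `roughCellSum`,
`roughCellDensity`, `HasIwaniecDimension`, `densityProduct`, `primesProdBelow`, `remainder`) is the sister kernel's
(`LeeYangFibresCellParityLawKernelDefs`).

The line (card `Cruxes/CellParityLawSaving/Ideas/superpoly-band-same-atom.md`, ideator sketch
`Cruxes/CellParityLawSaving/SketchIdeator3.lean`). The crux `LeeYangFibres.CellParityLawSaving` is the sister crux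
`LeeYangFibres.CellParityLaw` (stmt-Parity-14109) run ALONG THE SCHEDULE `u = U(N) = slowDegree N` with a LOG-POWER
saving `(log N)^{-δ}` in place of `ε`. The sister's landed architecture (line `section-annihilator`: effective law
`LawEffAt t` by induction on the number of forms, base = one progression segment, step = Bombieri's one-parameter
SECTION law for every coordinate section + tensor/Walsh assembly) is re-run along the schedule with budgets
`N/(log^t N · (log N)^δ)` between the layers (`LawSavAt`, `SectionLawSavAt`, `WalshStepSav`, `DensityBoundsAlong`,
`ComposeSav`); the section law along the schedule is to come from the card's two research inputs — the ATOM
`SectionLevelAlong t` (the sister atom `SectionLevelAt t`, typed tuple-GEH for the section sequences at level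
`N^{1-(log log N)^{-B}}`, with `N₀` uniform over the roughness `2 ≤ u ≤ U(N)`: a CONJECTURE by design of the route) and
the KERNEL `SuperPolyRoughCellLaw a` (Bombieri's rough-cell law for ONE sifted dimension-1 sequence, uniform in
`u ≤ √(log log x)`, with a super-polynomial rate `exp(-c η^{-a})` in the level deficit `η`; a RESEARCH statement — Ford's
fixed-level construction caps `a ≤ 2`, Friedlander–Iwaniec give the polynomial analogue, the truth in between is open)
— through the ENGINE `EngineSav` (the sister's 40-file finite-level engine re-run with explicit rates; crux-sized).
Along the schedule every `e^{O(U log U)}` quantity (ratios of bulk model densities, `2^{t+3}` Walsh constants,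
`(log log N)^D` singular-series ratios) is `(log N)^{o(1)}` because `4U² ≤ log log N` (`quantClip_schedule`), which
is why the Walsh step only halves the saving.

References: Bombieri, *The asymptotic sieve*, Rend. Accad. Naz. XL (1976) [BombieriAsymptoticSieve1976];
Friedlander–Iwaniec, Ann. Sc. Norm. Pisa (1978) §4 [FriedlanderIwaniecPisa1978]; K. Ford, *On Bombieri's asymptotic
sieve*, Trans. AMS 357 (2005) [Ford2004]; Green–Tao, Ann. of Math. 171 (2010) Conj. 1.4 [GreenTao2010]; Alladi,
Quart. J. Math. 33 (1982) [Alladi1982].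
-/

noncomputable section

open scoped BigOperators Classical
open Finset Filter Literature.NumberTheory.Sieve
open Summit.Parity.GeneralizedHardyLittlewood.Cruxes.CellParityLaw.SectionAnnihilator
open Summit.Parity.GeneralizedHardyLittlewood.Cruxes.AbsoluteUpgrade.DipMarginRateExchange (slowDegree
  four_le_slowDegree quantClip_schedule)

namespace Summit.Parity.GeneralizedHardyLittlewood.Cruxes.CellParityLawSaving.SuperPolyBand

/-! ## The law along the schedule (induction predicate) -/

/-- **The cell-parity law along the schedule with a log-power saving, for `t` forms** (`LawSavAt t`): VERBATIM
the body of `LeeYangFibres.CellParityLawSaving` at a fixed number of forms — for every size bound `L` some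
`δ > 0` and `N₀` such that for `N ≥ N₀`, every non-degenerate one-dimensional system `Ψ` of `t` forms with
`‖Ψ‖_N ≤ L` and every convex `K ⊆ [-N,N]` admit Walsh amplitudes `θ` (`θ_∅ = 1`, `|θ_S| ≤ 2`) with
`|C_j − W_θ(j) · β_∞ 𝔖 ∏_i a_{j_i}| ≤ N/(log^t N · (log N)^δ)` for all `j ∈ [1, U(N)]^t`, `U(N) = slowDegree N`
(`cell`, `walsh`, `modelDensity` unfold to the crux's inlined objects, `slowDegree N` to its inlined schedule).
The induction hypothesis of the line; type of the registered stub `stub_baseSav` at `t = 1`. -/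
def LawSavAt (t : ℕ) : Prop :=
  ∀ L : ℕ, ∃ δ : ℝ, 0 < δ ∧ ∃ N₀ : ℕ, ∀ N : ℕ, N₀ ≤ N →
    ∀ Ψ : Fin t → AffLinForm 1, IsNondegenerateSystem Ψ → affLinSize Ψ N ≤ L →
    ∀ K : Set (Fin 1 → ℝ), Convex ℝ K → K ⊆ realBox 1 N →
    ∃ θ : Finset (Fin t) → ℝ, θ ∅ = 1 ∧ (∀ S, |θ S| ≤ 2) ∧
      ∀ j : Fin t → ℕ, (∀ i, 1 ≤ j i ∧ j i ≤ slowDegree N) →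
        |(cell Ψ K N (slowDegree N) j : ℝ) -
            walsh θ j * (archFactor Ψ K * singularProduct Ψ * ∏ i, modelDensity N (slowDegree N) (j i))|
          ≤ (N : ℝ) / (Real.log N ^ t * Real.log N ^ δ)

/-! ## The section law along the schedule (output of the engine) -/

/-- **Bombieri's one-parameter section law along the schedule** (`SectionLawSavAt t`, systems of `t + 1 ≥ 2`
forms; conclusion of the engine stub `stub_engineSav`, hypothesis of the Walsh step): the sister's `SectionLawAt t`
with `u := U(N)` and the budget `N/(log^{t+1} N · (log N)^δ)` for SOME `δ = δ(t, L) > 0` — for each coordinate `i`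
and frozen cells `j' ∈ [1,U(N)]^t` ONE `δ' ∈ [0,2]` with
`C_{(m,j')} = (1 + (δ'-1)(-1)^m) · a_m · (𝔖(Ψ)/𝔖(Ψ₋ᵢ)) · F⁽ⁱ⁾_{j'} + O(N/(log^{t+1}N (log N)^δ))` for all
`m ∈ [1, U(N)]` (`F⁽ⁱ⁾_{j'} = sectionMass … 1`, the fibre mass; junk `x/0 = 0` only when `𝔖(Ψ₋ᵢ) = 0`, where every
section is empty). True in the Hardy–Littlewood world (`δ' = 1`). -/
def SectionLawSavAt (t : ℕ) : Prop :=
  ∀ L : ℕ, ∃ δ : ℝ, 0 < δ ∧ ∃ N₀ : ℕ, ∀ N : ℕ, N₀ ≤ N →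
    ∀ Ψ : Fin (t + 1) → AffLinForm 1, IsNondegenerateSystem Ψ → affLinSize Ψ N ≤ L →
    ∀ K : Set (Fin 1 → ℝ), Convex ℝ K → K ⊆ realBox 1 N →
    ∀ i : Fin (t + 1), ∀ j' : Fin t → ℕ, (∀ k, 1 ≤ j' k ∧ j' k ≤ slowDegree N) →
      ∃ δ' : ℝ, 0 ≤ δ' ∧ δ' ≤ 2 ∧ ∀ m : ℕ, 1 ≤ m → m ≤ slowDegree N →
        |(cell Ψ K N (slowDegree N) (i.insertNth m j') : ℝ) -
            (1 + (δ' - 1) * (-1 : ℝ) ^ m) * modelDensity N (slowDegree N) m *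
              (singularProduct Ψ / singularProduct (Fin.removeNth i Ψ)) *
                (sectionMass Ψ K N (slowDegree N) i j' 1 : ℝ)|
          ≤ (N : ℝ) / (Real.log N ^ (t + 1) * Real.log N ^ δ)

/-! ## Parity-free inputs of the Walsh step -/

/-- **Anatomy of rough integers along the schedule, in log-power currency** (`DensityBoundsAlong`; type of the
registered stub `stub_densityAlong`, provable now from the landed `AnatomyAlong`, p102212, and the density bounds
`1/(U^U)² ≤ I_m(U) ≤ U` of `LeeYangFibresAbsoluteUpgradeAnatomyAlongAux`): for every `ε > 0` and `N ≥ N₀(ε)`, with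
`U = U(N)`, every model density is `≤ (log N)^ε/log N`, the bulk ones `a_m`, `1 ≤ m < U`, are
`≥ (log N)^{-ε}/log N`, and `a_m = 0` for `m ≥ U` (a product of `U` primes `> N^{1/U}` exceeds `N`). The point:
`max_m a_m / min_{m<U} a_m ≤ e^{O(U log U)} = (log N)^{o(1)}` since `4U² ≤ log log N`. -/
def DensityBoundsAlong : Prop :=
  ∀ ε : ℝ, 0 < ε → ∃ N₀ : ℕ, ∀ N : ℕ, N₀ ≤ N →
    (∀ m : ℕ, modelDensity N (slowDegree N) m ≤ Real.log N ^ ε / Real.log N) ∧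
    (∀ m : ℕ, 1 ≤ m → m < slowDegree N → Real.log N ^ (-ε) / Real.log N ≤ modelDensity N (slowDegree N) m) ∧
    (∀ m : ℕ, slowDegree N ≤ m → modelDensity N (slowDegree N) m = 0)

/-- **The Walsh / tensor step along the schedule** (`WalshStepSav`; type of the registered stub
`stub_walshStepSav`, provable now): given the anatomy bounds along the schedule and the sister's landed
singular-series bookkeeping `SingularRatioBound` (`𝔖, 𝔖₋ᵢ ≥ 0`, `𝔖 ≤ C_s (log log N)^D 𝔖₋ᵢ`, `stub_singularRatio`),
the section law along the schedule for `(t+1)`-form systems and the law along the schedule for `t`-form systems give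
the law along the schedule for `(t+1)`-form systems. Port of the sister's `stub_walshStep`: the half-body identity
`sectionMass … 1 = cell (removeNth i Ψ) (K ∩ {ψ_i > 0})`, `archFactor (removeNth i Ψ) (K ∩ {ψ_i > 0}) = archFactor Ψ K`,
`(𝔖/𝔖₋ᵢ)·𝔖₋ᵢ = 𝔖`, then the abstract assembly `ParityWalsh.exists_walshSum_of_sections` with
`a₊/a₋ = (log N)^{2ε}`: from savings `δ₁` (sections) and `δ₂` (induction hypothesis) one gets every
`δ < min(δ₁, δ₂)` — the error `2^{t+3} (log N)^{2ε(t+1)} (1 + 2 C_s (log log N)^D (log N)^ε) N/(log N)^{t+1+min(δ₁,δ₂)}`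
is within `N/(log N)^{t+1+δ}` for `ε` small and `N` large. -/
def WalshStepSav : Prop :=
  DensityBoundsAlong → SingularRatioBound →
    ∀ t : ℕ, 1 ≤ t → SectionLawSavAt t → LawSavAt t → LawSavAt (t + 1)

/-! ## The research inputs of the line: atom and kernel (statements; NOT facts) -/

/-- **The atom along the schedule** (`SectionLevelAlong t`, systems of `t + 1 ≥ 2` forms; type of the registered
stub `stub_atom`): VERBATIM the sister crux's atom `SectionLevelAt t` — Bombieri's `(A₂)` for every coordinate
section sequence with the explicit rough-supported density `sectionDensity`, at level `N^{1 - (log log N)^{-B}}`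
with saving `(log N)^{-A}`, for all `A, B`, uniformly over systems of size `≤ L`, convex `K ⊆ [-N,N]`, coordinates
`i` and frozen cells `j'` — except that `N₀` is chosen BEFORE the roughness `u`, which ranges over `2 ≤ u ≤ U(N)`
(the schedule needs `u = U(N)`). A typed tuple-GEH statement: `t = 1` is an Elliott–Halberstam-type statement for
shifted rough `Ω`-cells at level `x^{1-o(1)}`, `t ≥ 2` relative equidistribution of prime-tuple-type sets — open at
every level beyond `1/2`. The whole conjectural input of the line (a statement, not a fact); it implies the sister
atom (`sectionLevelAt_of_along`). [Ideator 3 sketch `SketchIdeator3.lean`, with `slowDegree` of the dip line.] -/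
def SectionLevelAlong (t : ℕ) : Prop :=
  ∀ (L A B : ℕ), ∃ N₀ : ℕ, ∀ N : ℕ, N₀ ≤ N → ∀ u : ℕ, 2 ≤ u → u ≤ slowDegree N →
    ∀ Ψ : Fin (t + 1) → AffLinForm 1, IsNondegenerateSystem Ψ → affLinSize Ψ N ≤ L →
    ∀ K : Set (Fin 1 → ℝ), Convex ℝ K → K ⊆ realBox 1 N →
    ∀ i : Fin (t + 1), ∀ j' : Fin t → ℕ, (∀ k, 1 ≤ j' k ∧ j' k ≤ u) →
      ∑ d ∈ (Finset.Icc 1 ⌊(N : ℝ) ^ (1 - 1 / Real.log (Real.log N) ^ B)⌋₊).filter Squarefree,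
          |(sectionMass Ψ K N u i j' d : ℝ) - sectionDensity Ψ i d * sectionMass Ψ K N u i j' 1|
        ≤ (N : ℝ) / Real.log N ^ A

/-- **The kernel: super-polynomial-rate rough-cell law for ONE sifted sequence** (`SuperPolyRoughCellLaw a`; the
registered stub `stub_kernel` asserts it for SOME `a > 0`). VERBATIM ideator 3's statement over the sister kernel's
vocabulary: the hypotheses of `EffectiveRoughCellLaw` (one sifted sequence `𝒜` of dimension `Ω(1, L')`, weights
`≤ 1` supported on `(x/Λ, x]`, counting-function size, two-sided Mertens above `w₀`, Type-I remainders of ALL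
truncations at level `x^{1-η}` summing to `≤ R`), but (i) UNIFORM in the roughness `2 ≤ u ≤ √(log log x)` and (ii) with
the rate `exp(C u²)·exp(-c η^{-a})` in the level deficit `η` in place of a power `η^κ`: the parity-blind indeterminacy
of the rough `Ω`-cell COUNTS `roughCellSum 𝒜 x z m` (`z ∈ [x^{1/(u+1)}, x^{1/u}]`) around Bombieri's one-parameter
model `(1 + (δ-1)(-1)^m) · (I_m(s)/s) · e^γ V(z) · |𝒜|` (`s = log x/log z`) is super-polynomially small. RESEARCH
STATEMENT, not a fact: Ford's Theorem 3 construction (deviation `(2M)^{-M²}` at level `x^{1-1/M}`) refutes every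
`a > 2`; Friedlander–Iwaniec's dissection proves a polynomial rate; the truth in between is OPEN (barrier file
`Literature.Barriers.Parity.FordFixedLevelBarrier`, scope caveat (ii)). Any `a > 0` serves the line: with the atom at
level deficit `η = (log log N)^{-B}`, `aB > 1` makes `exp(-c η^{-a}) ≤ (log N)^{-δ}` for every `δ`
(ideator 3's proved `schedule_calibration`). [Ford2004, FriedlanderIwaniecPisa1978, BombieriAsymptoticSieve1976] -/
def SuperPolyRoughCellLaw (a : ℝ) : Prop :=
  ∀ (A₁ L' : ℝ), ∃ (c κ C : ℝ) (A₂ : ℕ) (x₀ : ℝ), 0 < c ∧ 0 < κ ∧ 0 ≤ C ∧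
    ∀ (u : ℕ) (𝒜 : SieveSequence) (x z η Λ w₀ R : ℝ), 2 ≤ u → x₀ ≤ x →
      (u : ℝ) ≤ Real.sqrt (Real.log (Real.log x)) →
      x ^ (1 / ((u : ℝ) + 1)) ≤ z → z ≤ x ^ (1 / (u : ℝ)) →
      Real.log x ^ (-(1 / 2 : ℝ)) ≤ η → η ≤ 1 / (4 * (u : ℝ)) →
      1 ≤ Λ → Λ ≤ x ^ η → 2 ≤ w₀ → w₀ ≤ x ^ η →
      (∀ q : ℕ, 𝒜.a q ≤ 1) → (∀ q : ℕ, x < (q : ℝ) → 𝒜.a q = 0) →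
      (∀ q : ℕ, (q : ℝ) ≤ x / Λ → 𝒜.a q = 0) →
      (∀ y : ℝ, 𝒜.size y = 𝒜.congrSum 1 y) → x ^ (1 - 1 / (4 * (u : ℝ))) ≤ 𝒜.size x →
      (∀ p : ℕ, p.Prime → 𝒜.density p ≤ A₁ / p) → HasIwaniecDimension 𝒜.density 1 L' →
      (∀ w z' : ℝ, w₀ ≤ w → w ≤ z' → z' ≤ x →
          Real.log z' / Real.log w * (1 - L' / Real.log w) ≤
            ∏ p ∈ (Nat.primesBelow ⌈z'⌉₊).filter (fun p : ℕ => w ≤ (p : ℝ)), (1 - 𝒜.density p)⁻¹) →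
      (∀ y : ℝ, y ≤ x →
          ∑ d ∈ (Finset.Icc 1 ⌊x ^ (1 - η)⌋₊).filter Squarefree, |𝒜.remainder d y| ≤ R) →
      ∃ δ : ℝ, 0 ≤ δ ∧ δ ≤ 2 ∧ ∀ m : ℕ, 1 ≤ m →
        |roughCellSum 𝒜 x z m -
            (1 + (δ - 1) * (-1 : ℝ) ^ m) *
              (roughCellDensity m (Real.log x / Real.log z) / (Real.log x / Real.log z)) *
              (Real.exp Real.eulerMascheroniConstant * 𝒜.densityProduct (primesProdBelow z)) *
                𝒜.size x|
          ≤ C * (Real.exp (C * (u : ℝ) ^ 2) * Real.exp (-(c * η ^ (-a))) + Real.log z ^ (-κ) +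
                  Real.log (2 * Λ) / Real.log z) *
                (𝒜.densityProduct (primesProdBelow z) * 𝒜.size x) +
              C * Real.log x ^ A₂ * R

/-- **The engine along the schedule** (`EngineSav`; type of the registered stub `stub_engineSav`, held by the lead;
crux-sized): the kernel for some exponent `a > 0` and the atom along the schedule give Bombieri's one-parameter section
law along the schedule for every number `t + 1 ≥ 2` of forms. This is the sister line's finite-level engine
(`sectionLaw_strong`: section sequences in Bombieri's normalisation, inheritance of kernel-admissibility by the
fibres, Alladi with rate, Euler-ratio identity, conversion — `Theorems/LeeYangFibresCellParityLaw{SieveDefs,KernelDefs,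
P2Defs,GeThree*,Induction*,…}`) re-run at `u = U(N)` with the kernel's rate `exp(Cu²)exp(-cη^{-a})` taken at the
atom's deficit `η = (log log N)^{-B}`, `aB > 1` (`schedule_calibration`), the kernel constants `e^{O(u²)} = (log N)^{O(1)}`
folded into the atom's saving `(log N)^{-A}`, `(log z)^{-κ} = (U/log N)^κ` and the localisation `log(2Λ)/log z`
forcing only `δ < min(κ, 1)`. Not a fact: a line statement whose two hypotheses are the line's research inputs. -/
def EngineSav : Prop :=
  (∃ a : ℝ, 0 < a ∧ SuperPolyRoughCellLaw a) → (∀ t : ℕ, 1 ≤ t → SectionLevelAlong t) →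
    ∀ t : ℕ, 1 ≤ t → SectionLawSavAt t

/-! ## Composition (pure logic; proved) -/

/-- **The composition step** (`ComposeSav`): anatomy along the schedule → singular-series bookkeeping → Walsh step →
base → section laws give the law along the schedule for EVERY number of forms `t ≥ 1`. Pure logic (induction on
`t`); proved below as `composeSav`. -/
def ComposeSav : Prop :=
  DensityBoundsAlong → SingularRatioBound → WalshStepSav → LawSavAt 1 →
    (∀ t : ℕ, 1 ≤ t → SectionLawSavAt t) → ∀ t : ℕ, 1 ≤ t → LawSavAt t

/-- **`composeSav`** (pure logic): `LawSavAt t` for every `t ≥ 1`, by induction on `t` from the base `t = 1`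
through the Walsh step fed with the section law of the engine. -/
theorem composeSav : ComposeSav := by
  intro hDens hSing hStep hBase hSec t ht
  induction t, ht using Nat.le_induction with
  | base => exact hBase
  | succ t ht ih => exact hStep hDens hSing t ht (hSec t ht) ih

/-- **The reduction** (pure logic): the law along the schedule for every number of forms IS the crux — the body of
`LawSavAt t` is verbatim that of `LeeYangFibres.CellParityLawSaving` at `t` forms (`cell`, `walsh`, `modelDensity`,
`slowDegree` unfold to the route decl's inlined objects). -/
theorem cellParityLawSaving_of_lawSavAt (h : ∀ t : ℕ, 1 ≤ t → LawSavAt t) :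
    Summit.Parity.GeneralizedHardyLittlewood.Theses.LeeYangFibres.CellParityLawSaving := by
  intro t L ht
  exact h t ht L

/-- The converse bookkeeping: the crux gives the law along the schedule at every `t ≥ 1` (so the two are
equivalent; recorded for consumers that want `LawSavAt` by name). -/
theorem lawSavAt_of_cellParityLawSaving
    (h : Summit.Parity.GeneralizedHardyLittlewood.Theses.LeeYangFibres.CellParityLawSaving) :
    ∀ t : ℕ, 1 ≤ t → LawSavAt t := by
  intro t ht L
  exact h t L ht

/-- **The atom along the schedule implies the sister atom** (bookkeeping): at each FIXED roughness `u ≥ 2` one has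
`u ≤ U(N)` for all large `N` (`quantClip_schedule`), so `SectionLevelAlong t → SectionLevelAt t`. In particular a
refutation of the sister crux's atom refutes this line's atom. -/
theorem sectionLevelAt_of_along {t : ℕ} (h : SectionLevelAlong t) : SectionLevelAt t := by
  intro L u A B hu
  obtain ⟨N₁, hN₁⟩ := h L A B
  obtain ⟨N₂, hN₂⟩ := quantClip_schedule u
  refine ⟨max N₁ N₂, fun N hN Ψ hΨ hL K hK hKN i j' hj' => ?_⟩
  have h1 : N₁ ≤ N := le_trans (le_max_left _ _) hN
  have h2 : N₂ ≤ N := le_trans (le_max_right _ _) hN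
  exact hN₁ N h1 u hu (hN₂ N h2).1 Ψ hΨ hL K hK hKN i j' hj'

end Summit.Parity.GeneralizedHardyLittlewood.Cruxes.CellParityLawSaving.SuperPolyBand

end
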